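import Literature.NumberTheory.EllipticCurves.ZpExtensionEisensteinTwistKolyvaginPrimesProofs
import Literature.NumberTheory.EllipticCurves.ZpExtensionEisensteinTwistFreeProofs
import Literature.NumberTheory.EllipticCurves.ZpExtensionEisensteinTwistDualityForm
import Literature.NumberTheory.EllipticCurves.ZpExtensionUnramifiedProofs
import Literature.NumberTheory.EllipticCurves.ZpExtensionEisensteinAdicTower
import Literature.NumberTheory.GaloisCohomology.Howard2004.DVRKolyvaginBound
import Literature.NumberTheory.GaloisCohomology.Howard2004.FrobIdealProofs
import HarnessLib

/-!
# `𝓛₀(T_𝔮/p^k T_𝔮) = 𝓛₀(E[p^k])` and `𝓛_s(T_𝔮) ⊆ 𝓛_1(E[p^k])`: ramification and Kolyvagin primes of Howard's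
# Eisenstein levels `E[p^k] ⊗ A_{m,k}(ψ)` versus those of `E[p^k]` (theorems only; no definition, no named fact)

Topic `NumberTheory/EllipticCurves` (D1 road of cell `pub/bsd-print-x9`; companion of
`ZpExtensionEisensteinTwistKolyvaginPrimesProofs` (the Frobenius clauses), `ZpExtensionEisensteinSelmerUnramifiedProofs`
(good reduction ⇒ the twist is unramified) and `ZpExtensionEisensteinAdicTower` (the tower `k ↦ T_𝔮/p^k T_𝔮` as a
`Howard2004.AdicTower` over `S_m = Λ/(T^m + p)`)).

B. Howard, *The Heegner point Kolyvagin system*, Compositio Math. 140 (2004) (arXiv:1202.6340): §1.2 defines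
`𝓛₀(T)` = the degree-two primes `λ ∤ p` of `K` at which `T` is unramified and `𝓛_s(T) = {λ ∈ 𝓛₀ : I_ℓ ⊆ p^s R}`
(Def. 1.2.1); Thm. 1.6.1 asks «`𝓛_s(T) ⊂ 𝓛` for `s ≫ 0`»; in the proof of Thm. 2.2.10 the abstract theory is applied
to `T_𝔮 = 𝐓 ⊗_Λ S_𝔮` whose `p`-adic levels are `T_𝔮/p^k = E[p^k] ⊗ A_{m,k}(ψ)` (tree:
`ZpExtension.eisensteinTwist κ (E[p^k]) hm k` on `IwasawaAlgebra.EisensteinCoeff.Twisted p m k E[p^k]`), while the source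
Kolyvagin system lives on `𝓛 = 𝓛_1` of the curve (§2.3: «Define `𝓛 = 𝓛_1(𝐓)`»). This file proves the
dictionary between the two prime sets, for an ARBITRARY `ℤ_p`-extension `κ` (no anticyclotomic hypothesis):

* §1 algebra: `mem_ideal_span_natCast_pow_smul_top_iff` (`x ∈ (q^s)•N ↔ x = q^s • y`);
  `Twisted.tmul_one_injective_of_addEquiv` — `a ↦ 1 ⊗ a : M → M ⊗ A_{m,k}` is injective for `M ≅ (ℤ/p^k)^ι`
  (coordinates in the basis `Twisted.basisOfAddEquiv` and `char A_{m,k} = p^k`, tree `EisensteinCoeff.charP`);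
  `IwasawaAlgebra.dvd_of_natCast_mem_span_pow_quotient` — `(n : S_m) ∈ (p^s)`, `s ≥ 1` ⇒ `p ∣ n`.
* §2 (generic `ρ`): at `v ∤ p` every inertia group lies in `ker κ` (Washington 13.2, tree
  `ZpExtension.inertia_le_kerSubgroup_holds`), where the twist acts through `1 ⊗ ρ`; hence
  `isUnramifiedAt_eisensteinTwist_of_isUnramifiedAt` and, when `a ↦ 1 ⊗ a` is injective, the converse
  `isUnramifiedAt_of_isUnramifiedAt_eisensteinTwist`; so **`degreeTwoPrimes_eisensteinTwist_eq`**: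
  `𝓛₀(M ⊗ A_{m,k}(ψ)) = 𝓛₀(M)` (typed `Howard2004.degreeTwoPrimes`).
* §3 (the curve): `tmul_one_geomTorsion_injective`, **`isUnramifiedAt_eisensteinTwist_torsionGaloisModule_iff`**,
  **`degreeTwoPrimes_eisensteinTwist_torsionGaloisModule_eq`**, and the typed containment
  **`kolyvaginPrimes_eisensteinTwist_subset` : `𝓛_s(E[p^k] ⊗ A_{m,k}(ψ)) ⊆ 𝓛_1(E[p^k])`** (`k, s ≥ 1`; left over
  `R = A_{m,k}`, right over `R = ℤ`), assembled from the Frobenius clauses of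
  `ZpExtensionEisensteinTwistKolyvaginPrimesProofs` and `frobIdeal_mem_of_free` (H.0 for the twist, tree
  `free_twisted_geomTorsion`).
* §4 (the tower over `S_m`): `EisensteinLevel.mem_span_pow_smul_top_iff` (the `S_m`-ideal `(p^s)` and the
  `A_{m,k}`-ideal `(p^s)` cut out the same subgroup of a level), **`degreeTwoPrimes_eisensteinAdicTower_eq`**
  (`𝓛₀` of the tower `= ⋂_k 𝓛₀(E[p^k])`) and **`kolyvaginPrimes_eisensteinAdicTower_subset`** /
  **`kolyvaginPrimes_eisensteinAdicTowerSucc_subset`**: `𝓛_s` of the tower (lit's `AdicTower.kolyvaginPrimes`, the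
  set quantified in `DVRSetting.LargePrimes`) is contained in `⋂_k 𝓛_1(E[p^{k+1}])` for every `s ≥ 1`.

Theorems only; nothing about Selmer groups or `L`-functions is asserted; no `sorry`. BSD is not proved by any of this.

References: [Howard2004HeegnerKolyvagin] §1.2 (arXiv p. 6 L54–68), Def. 1.2.1, Thm. 1.6.1, §2.2 and proof of Thm. 2.2.10,
§2.3 (arXiv p. 18 L65); [Washington1997] Prop. 13.2; [SilvermanAEC2009] Cor. III.6.4(b).
-/

noncomputable section

open scoped TensorProduct ContRepresentation
open Field IsDedekindDomain NumberField

universe u w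

namespace Literature.NumberTheory.EllipticCurves

open Literature.NumberTheory.GaloisRepresentations Literature.NumberTheory.GaloisCohomology

/-! ## §1 Algebra: `(q^s) • N`, injectivity of `a ↦ 1 ⊗ a`, the `ℓ + 1` clause over `S_m` -/

/-- `x ∈ (q^s) • N ↔ x = q^s • y` for a natural number `q` read in any commutative ring `R` acting on `N`.
[cite: Howard2004HeegnerKolyvagin, Def. 1.2.1 (I_ℓ ⊆ p^s R)] -/
theorem mem_ideal_span_natCast_pow_smul_top_iff {R : Type*} {N : Type*} [CommRing R] [AddCommGroup N] [Module R N]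
    (q s : ℕ) (x : N) :
    x ∈ (Ideal.span {((q : ℕ) : R) ^ s} • (⊤ : Submodule R N) : Submodule R N) ↔ ∃ y : N, x = q ^ s • y := by
  rw [Submodule.ideal_span_singleton_smul, Submodule.mem_smul_pointwise_iff_exists]
  constructor
  · rintro ⟨y, -, rfl⟩
    exact ⟨y, by rw [← Nat.cast_pow, Nat.cast_smul_eq_nsmul]⟩
  · rintro ⟨y, rfl⟩
    exact ⟨y, Submodule.mem_top, by rw [← Nat.cast_pow, Nat.cast_smul_eq_nsmul]⟩

namespace IwasawaAlgebra

variable (p : ℕ) [hp : Fact p.Prime]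

/-- **`a ↦ 1 ⊗ a : M → M ⊗ A_{m,k}` is injective when `M ≅ (ℤ/p^k)^ι`** (`m ≥ 1`): the `i`-th coordinate of `1 ⊗ a`
in the `A_{m,k}`-basis `1 ⊗ e⁻¹(δ_i)` is the image of `e(a)_i` under `ℤ/p^k ↪ A_{m,k}`, injective because
`char A_{m,k} = p^k`. [cite: Howard2004HeegnerKolyvagin, §1.3 H.0 and §2.2 (T_𝔮/p^k = T_p E/p^k ⊗ S_𝔮/p^k)]
[cite: BourbakiAlgebre1a3, Ch. II §5 no. 1 Prop. 4] -/
theorem EisensteinCoeff.Twisted.tmul_one_injective_of_addEquiv {m k : ℕ} (hm : 1 ≤ m) {M : Type w}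
    [AddCommGroup M] {ι : Type*} [Fintype ι] [DecidableEq ι] (e : M ≃+ (ι → ZMod (p ^ k))) :
    Function.Injective fun a : M ↦ EisensteinCoeff.Twisted.tmul (1 : EisensteinCoeff p m k) a := by
  intro a b hab
  have h : ∀ i, (ZMod.cast (e a i) : EisensteinCoeff p m k) = ZMod.cast (e b i) := fun i ↦ by
    have h' := congrArg (fun x ↦ (EisensteinCoeff.Twisted.basisOfAddEquiv (m := m) e).repr x i) hab
    simpa only [EisensteinCoeff.Twisted.basisOfAddEquiv_repr_tmul, one_mul] using h'
  haveI := EisensteinCoeff.charP p hm k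
  have hinj := ZMod.castHom_injective (n := p ^ k) (EisensteinCoeff p m k)
  apply e.injective
  funext i
  apply hinj
  rw [ZMod.castHom_apply, ZMod.castHom_apply]
  exact h i

/-- **The `ℓ + 1` clause over `S_m = Λ/(T^m + p)`**: `(n : S_m) ∈ (p^s)` with `s ≥ 1` (`m ≥ 1`) forces `p ∣ n`
(push to `A_{m,1} = S_m/p` and use `EisensteinCoeff.dvd_of_natCast_mem_span_pow`).
[cite: Howard2004HeegnerKolyvagin, Def. 1.2.1 (p^s ∣ ℓ + 1) and proof of Thm. 2.2.10 (𝔮 = T^m + p)] -/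
theorem dvd_of_natCast_mem_span_pow_quotient {m : ℕ} (hm : 1 ≤ m) {s : ℕ} (hs : 1 ≤ s) {n : ℕ}
    (hn : ((n : ℕ) : IwasawaAlgebra p ⧸
        Ideal.span {(PowerSeries.X ^ m + PowerSeries.C (p : ℤ_[p]) : IwasawaAlgebra p)}) ∈
      Ideal.span {((p : ℕ) : IwasawaAlgebra p ⧸
        Ideal.span {(PowerSeries.X ^ m + PowerSeries.C (p : ℤ_[p]) : IwasawaAlgebra p)}) ^ s}) :
    p ∣ n := by
  set I : Ideal (IwasawaAlgebra p) :=
    Ideal.span {(PowerSeries.X ^ m + PowerSeries.C (p : ℤ_[p]) : IwasawaAlgebra p)} with hI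
  let φ : IwasawaAlgebra p ⧸ I →+* EisensteinCoeff p m 1 :=
    Ideal.Quotient.lift I (Ideal.Quotient.mk (I ⊔ Ideal.span {PowerSeries.C ((p : ℤ_[p]) ^ 1)}))
      (fun _ ha ↦ Ideal.Quotient.eq_zero_iff_mem.mpr (Ideal.mem_sup_left ha))
  obtain ⟨a, ha⟩ := Ideal.mem_span_singleton'.mp hn
  have ha' : φ a * ((p : ℕ) : EisensteinCoeff p m 1) ^ s = (n : EisensteinCoeff p m 1) := by
    have := congrArg φ ha
    rwa [map_mul, map_pow φ, map_natCast φ, map_natCast φ] at this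
  exact EisensteinCoeff.dvd_of_natCast_mem_span_pow p hm le_rfl hs (Ideal.mem_span_singleton'.mpr ⟨φ a, ha'⟩)

end IwasawaAlgebra

/-! ## §2 Ramification of `M ⊗ A_{m,k}(ψ)` versus `M` at `v ∤ p` (generic `ρ`) -/

namespace ZpExtension

open IwasawaAlgebra

variable {K : Type u} [Field K] [NumberField K] {p : ℕ} [hp : Fact p.Prime] (κ : ZpExtension K p)
  {M : Type w} [AddCommGroup M] [TopologicalSpace M] [DiscreteTopology M] (ρ : DiscreteGaloisModule K M)
  {m : ℕ} (hm : 1 ≤ m) (k : ℕ)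

/-- **`M` unramified at `v ∤ p` ⇒ `M ⊗ A_{m,k}(ψ)` unramified at `v`**: inertia at `v` lies in `ker κ` (a
`ℤ_p`-extension is unramified outside `p`), where `σ` acts by `1 ⊗ ρ(σ) = 1`.
[cite: Howard2004HeegnerKolyvagin, §1.2 (𝓛₀) and §2.2] [cite: Washington1997, Prop. 13.2] -/
theorem isUnramifiedAt_eisensteinTwist_of_isUnramifiedAt {v : HeightOneSpectrum (𝓞 K)}
    (hpv : ((p : ℕ) : 𝓞 K) ∉ v.asIdeal) (hur : GaloisRep.IsUnramifiedAt v ρ) :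
    GaloisRep.IsUnramifiedAt v (κ.eisensteinTwist ρ hm k) := by
  intro 𝔓 h𝔓 τ hτ
  have hτk : τ ∈ κ.kerSubgroup := ZpExtension.inertia_le_kerSubgroup_holds K p κ hpv h𝔓 hτ
  have h1 : ρ τ = 1 := hur 𝔓 h𝔓 τ hτ
  refine LinearMap.ext fun x ↦ ?_
  change κ.eisensteinTwist ρ hm k τ x = x
  exact κ.eisensteinTwist_apply_eq_self_of_mem_kerSubgroup ρ hm k hτk (fun a ↦ by rw [h1]; rfl) x

/-- **`M ⊗ A_{m,k}(ψ)` unramified at `v ∤ p` ⇒ `M` unramified at `v`**, provided `a ↦ 1 ⊗ a` is injective (e.g.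
`M ≅ (ℤ/p^k)^ι`): for `τ` in an inertia group at `v`, `τ ∈ ker κ`, so `1 ⊗ ρ(τ)a = τ·(1 ⊗ a) = 1 ⊗ a`.
[cite: Howard2004HeegnerKolyvagin, §1.2 (𝓛₀) and §2.2] [cite: Washington1997, Prop. 13.2] -/
theorem isUnramifiedAt_of_isUnramifiedAt_eisensteinTwist {v : HeightOneSpectrum (𝓞 K)}
    (hpv : ((p : ℕ) : 𝓞 K) ∉ v.asIdeal)
    (hinj : Function.Injective fun a : M ↦ EisensteinCoeff.Twisted.tmul (1 : EisensteinCoeff p m k) a)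
    (hur : GaloisRep.IsUnramifiedAt v (κ.eisensteinTwist ρ hm k)) : GaloisRep.IsUnramifiedAt v ρ := by
  intro 𝔓 h𝔓 τ hτ
  have hτk : τ ∈ κ.kerSubgroup := ZpExtension.inertia_le_kerSubgroup_holds K p κ hpv h𝔓 hτ
  have h1 : κ.eisensteinTwist ρ hm k τ = 1 := hur 𝔓 h𝔓 τ hτ
  refine LinearMap.ext fun a ↦ ?_
  change ρ τ a = a
  apply hinj
  change EisensteinCoeff.Twisted.tmul (1 : EisensteinCoeff p m k) (ρ τ a) =
    EisensteinCoeff.Twisted.tmul (1 : EisensteinCoeff p m k) a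
  rw [← κ.eisensteinTwist_apply_tmul_of_mem_kerSubgroup ρ hm k hτk 1 a, h1]
  rfl

end ZpExtension

namespace ZpExtension

open IwasawaAlgebra

-- `Howard2004.degreeTwoPrimes` lives in universe `0` (lit's `SelmerTriples`), whence `K M : Type` here.
variable {K : Type} [Field K] [NumberField K] {p : ℕ} [hp : Fact p.Prime] (κ : ZpExtension K p)
  {M : Type} [AddCommGroup M] [TopologicalSpace M] [DiscreteTopology M] (ρ : DiscreteGaloisModule K M)
  {m : ℕ} (hm : 1 ≤ m) (k : ℕ)

/-- **`𝓛₀(M ⊗ A_{m,k}(ψ)) = 𝓛₀(M)`** (typed `Howard2004.degreeTwoPrimes`: degree-two primes `∤ p` at which the module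
is unramified), whenever `a ↦ 1 ⊗ a` is injective. [cite: Howard2004HeegnerKolyvagin, §1.2 (arXiv p. 6, L57–60) and §2.2]
[cite: Washington1997, Prop. 13.2] -/
theorem degreeTwoPrimes_eisensteinTwist_eq
    (hinj : Function.Injective fun a : M ↦ EisensteinCoeff.Twisted.tmul (1 : EisensteinCoeff p m k) a) :
    Howard2004.degreeTwoPrimes p (κ.eisensteinTwist ρ hm k) = Howard2004.degreeTwoPrimes p ρ := by
  ext v
  exact ⟨fun hv ↦ ⟨hv.1, hv.2.1, κ.isUnramifiedAt_of_isUnramifiedAt_eisensteinTwist ρ hm k hv.2.1 hinj hv.2.2⟩,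
    fun hv ↦ ⟨hv.1, hv.2.1, κ.isUnramifiedAt_eisensteinTwist_of_isUnramifiedAt ρ hm k hv.2.1 hv.2.2⟩⟩

/-- `𝓛₀(M) ⊆ 𝓛₀(M ⊗ A_{m,k}(ψ))` unconditionally. [cite: Howard2004HeegnerKolyvagin, §1.2 and §2.2] [cite: Washington1997, Prop. 13.2] -/
theorem degreeTwoPrimes_subset_degreeTwoPrimes_eisensteinTwist :
    Howard2004.degreeTwoPrimes p ρ ⊆ Howard2004.degreeTwoPrimes p (κ.eisensteinTwist ρ hm k) :=
  fun _ hv ↦ ⟨hv.1, hv.2.1, κ.isUnramifiedAt_eisensteinTwist_of_isUnramifiedAt ρ hm k hv.2.1 hv.2.2⟩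

end ZpExtension

end Literature.NumberTheory.EllipticCurves

/-! ## §3 The curve: `𝓛₀(E[p^k] ⊗ A_{m,k}(ψ)) = 𝓛₀(E[p^k])`, `𝓛_s(E[p^k] ⊗ A_{m,k}(ψ)) ⊆ 𝓛_1(E[p^k])` -/

namespace WeierstrassCurve

open Literature.NumberTheory.EllipticCurves Literature.NumberTheory.GaloisRepresentations
open Literature.NumberTheory.EllipticCurves.IwasawaAlgebra Literature.NumberTheory.GaloisCohomology

section Field

variable {F : Type u} [Field F] (W : WeierstrassCurve F) [W.IsElliptic] {p : ℕ} [hp : Fact p.Prime] {m : ℕ}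

/-- **`P ↦ 1 ⊗ P : E[p^k] → E[p^k] ⊗ A_{m,k}` is injective** (`p ∤ char F`, `m ≥ 1`), since `E[p^k] ≅ (ℤ/p^k)²`.
[cite: Howard2004HeegnerKolyvagin, §2.2 (T_𝔮/p^k = T_p E/p^k ⊗ S_𝔮/p^k)] [cite: SilvermanAEC2009, Cor. III.6.4(b)] -/
theorem tmul_one_geomTorsion_injective (hpF : (p : F) ≠ 0) (hm : 1 ≤ m) (k : ℕ) :
    Function.Injective fun P : geomTorsion W ((p : ℤ) ^ k) ↦
      EisensteinCoeff.Twisted.tmul (1 : EisensteinCoeff p m k) P := by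
  classical
  obtain ⟨e⟩ := W.nonempty_geomTorsion_prime_pow_addEquiv_fin_two hpF k
  exact EisensteinCoeff.Twisted.tmul_one_injective_of_addEquiv p hm e

end Field

section NumberField

variable {K : Type} [Field K] [NumberField K] (W : WeierstrassCurve K) [W.IsElliptic] {p : ℕ} [hp : Fact p.Prime]
  (κ : ZpExtension K p) {m : ℕ} (hm : 1 ≤ m)

/-- **`E[p^k] ⊗ A_{m,k}(ψ)` is unramified at `v ∤ p` iff `E[p^k]` is.**
[cite: Howard2004HeegnerKolyvagin, §1.2 (𝓛₀) and §2.2] [cite: Washington1997, Prop. 13.2] [cite: SilvermanAEC2009, Cor. III.6.4(b)] -/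
theorem isUnramifiedAt_eisensteinTwist_torsionGaloisModule_iff {v : HeightOneSpectrum (𝓞 K)}
    (hpv : ((p : ℕ) : 𝓞 K) ∉ v.asIdeal) (k : ℕ) :
    GaloisRep.IsUnramifiedAt v (κ.eisensteinTwist (W.torsionGaloisModule ((p : ℤ) ^ k)) hm k) ↔
      GaloisRep.IsUnramifiedAt v (W.torsionGaloisModule ((p : ℤ) ^ k)) :=
  have hpK : (p : K) ≠ 0 := Nat.cast_ne_zero.mpr hp.out.ne_zero
  ⟨κ.isUnramifiedAt_of_isUnramifiedAt_eisensteinTwist _ hm k hpv (W.tmul_one_geomTorsion_injective hpK hm k),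
    κ.isUnramifiedAt_eisensteinTwist_of_isUnramifiedAt _ hm k hpv⟩

/-- **`𝓛₀(E[p^k] ⊗ A_{m,k}(ψ)) = 𝓛₀(E[p^k])`** (typed `Howard2004.degreeTwoPrimes`).
[cite: Howard2004HeegnerKolyvagin, §1.2 (arXiv p. 6, L57–60) and §2.2] [cite: Washington1997, Prop. 13.2] -/
theorem degreeTwoPrimes_eisensteinTwist_torsionGaloisModule_eq (k : ℕ) :
    Howard2004.degreeTwoPrimes p (κ.eisensteinTwist (W.torsionGaloisModule ((p : ℤ) ^ k)) hm k) =
      Howard2004.degreeTwoPrimes p (W.torsionGaloisModule ((p : ℤ) ^ k)) :=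
  have hpK : (p : K) ≠ 0 := Nat.cast_ne_zero.mpr hp.out.ne_zero
  κ.degreeTwoPrimes_eisensteinTwist_eq _ hm k (W.tmul_one_geomTorsion_injective hpK hm k)

/-- **The explicit content of `λ ∈ 𝓛_s(E[p^k] ⊗ A_{m,k}(ψ))`** read on the curve (`k, s ≥ 1`): if `λ ∤ p` is a degree-two
prime at which the twist is unramified, `ℓ + 1 ∈ (p^s) ⊆ A_{m,k}` and `Frob_λ ≡ 1 (mod p^s)` on the twist, then
`E[p^k]` is unramified at `λ`, `p ∣ ℓ + 1`, and `Frob_λ ≡ 1 (mod p)` on `E[p^k]`.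
[cite: Howard2004HeegnerKolyvagin, Def. 1.2.1, Thm. 1.6.1 («𝓛_s(T) ⊂ 𝓛») and §2.3 (𝓛 = 𝓛_1)] [cite: Washington1997, Prop. 13.2] -/
theorem kolyvaginPrimes_conditions_of_eisensteinTwist {k : ℕ} (hk : 1 ≤ k) {s : ℕ} (hs : 1 ≤ s)
    {v : HeightOneSpectrum (𝓞 K)} (hv : v ∈ Howard2004.degreeTwoPrimes p
      (κ.eisensteinTwist (W.torsionGaloisModule ((p : ℤ) ^ k)) hm k))
    (h₁ : ((Howard2004.residueChar v + 1 : ℕ) : EisensteinCoeff p m k) ∈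
      Ideal.span {((p : ℕ) : EisensteinCoeff p m k) ^ s})
    (h₂ : ∀ σ : absoluteGaloisGroup K, IsArithFrobAtPlace K v σ →
      ∀ x : EisensteinCoeff.Twisted p m k (geomTorsion W ((p : ℤ) ^ k)),
        κ.eisensteinTwist (W.torsionGaloisModule ((p : ℤ) ^ k)) hm k σ x - x ∈
          (Ideal.span {((p : ℕ) : EisensteinCoeff p m k) ^ s} •
            (⊤ : Submodule (EisensteinCoeff p m k) (EisensteinCoeff.Twisted p m k (geomTorsion W ((p : ℤ) ^ k)))))) :
    v ∈ Howard2004.degreeTwoPrimes p (W.torsionGaloisModule ((p : ℤ) ^ k)) ∧ p ∣ Howard2004.residueChar v + 1 ∧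
      ∀ σ : absoluteGaloisGroup K, IsArithFrobAtPlace K v σ →
        ∀ P : geomTorsion W ((p : ℤ) ^ k), ∃ Q : geomTorsion W ((p : ℤ) ^ k), σ • P - P = p • Q := by
  refine ⟨?_, EisensteinCoeff.dvd_of_natCast_mem_span_pow p hm hk hs h₁, fun σ hσ P ↦
    W.exists_smul_sub_eq_prime_nsmul_of_eisensteinTwist_sub_mem κ hm hk hs (h₂ σ hσ) P⟩
  rwa [W.degreeTwoPrimes_eisensteinTwist_torsionGaloisModule_eq κ hm k] at hv

omit [W.IsElliptic] hp in
/-- Membership in `𝓛_1(E[p^k])` (typed over `R = ℤ`) from the explicit conditions: degree two, `λ ∤ p`, `E[p^k]`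
unramified, `p ∣ ℓ + 1`, `Frob_λ P − P ∈ p·E[p^k]`. [cite: Howard2004HeegnerKolyvagin, Def. 1.2.1 (arXiv p. 6, L63–68)] -/
theorem mem_kolyvaginPrimes_torsionGaloisModule_one {k : ℕ} {v : HeightOneSpectrum (𝓞 K)}
    (hv : v ∈ Howard2004.degreeTwoPrimes p (W.torsionGaloisModule ((p : ℤ) ^ k)))
    (h₁ : p ∣ Howard2004.residueChar v + 1)
    (h₂ : ∀ σ : absoluteGaloisGroup K, IsArithFrobAtPlace K v σ →
      ∀ P : geomTorsion W ((p : ℤ) ^ k), ∃ Q : geomTorsion W ((p : ℤ) ^ k), σ • P - P = p • Q) :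
    v ∈ Howard2004.kolyvaginPrimes (R := ℤ) p (W.torsionGaloisModule ((p : ℤ) ^ k)) 1 := by
  refine Howard2004.mem_kolyvaginPrimes_of_forall (R := ℤ) p _ 1 hv ?_ fun σ hσ P ↦ ?_
  · rw [pow_one, Ideal.mem_span_singleton]
    exact_mod_cast h₁
  · obtain ⟨Q, hQ⟩ := h₂ σ hσ P
    rw [torsionGaloisModule_apply_apply, hQ, mem_ideal_span_natCast_pow_smul_top_iff]
    exact ⟨Q, by rw [pow_one]⟩

/-- **`𝓛_s(E[p^k] ⊗ A_{m,k}(ψ)) ⊆ 𝓛_1(E[p^k])`** (`k, s ≥ 1`; typed `Howard2004.kolyvaginPrimes`, the left over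
`R = A_{m,k}` — where `I_ℓ` has its defining property because the twist is free (H.0, `frobIdeal_mem_of_free`) — the
right over `R = ℤ`): Howard's «`𝓛_s(T) ⊂ 𝓛`» for `T = T_𝔮`, `𝓛 = 𝓛_1` of the curve, level by level.
[cite: Howard2004HeegnerKolyvagin, Def. 1.2.1, Thm. 1.6.1 («𝓛_s(T) ⊂ 𝓛 for s ≫ 0»), proof of Thm. 2.2.10 and §2.3 (𝓛 = 𝓛_1)]
[cite: Washington1997, Prop. 13.2] -/
theorem kolyvaginPrimes_eisensteinTwist_subset {k : ℕ} (hk : 1 ≤ k) {s : ℕ} (hs : 1 ≤ s) :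
    Howard2004.kolyvaginPrimes (R := EisensteinCoeff p m k) p
        (κ.eisensteinTwist (W.torsionGaloisModule ((p : ℤ) ^ k)) hm k) s ⊆
      Howard2004.kolyvaginPrimes (R := ℤ) p (W.torsionGaloisModule ((p : ℤ) ^ k)) 1 := by
  intro v hv
  have hpK : (p : K) ≠ 0 := Nat.cast_ne_zero.mpr hp.out.ne_zero
  haveI := W.free_twisted_geomTorsion (m := m) hpK k
  have hfrob := Howard2004.frobIdeal_mem_of_free (R := EisensteinCoeff p m k)
    (κ.eisensteinTwist (W.torsionGaloisModule ((p : ℤ) ^ k)) hm k) v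
  obtain ⟨hv', hdvd, hF⟩ := W.kolyvaginPrimes_conditions_of_eisensteinTwist κ hm hk hs hv.1 (hv.2 hfrob.1)
    (fun σ hσ x ↦ Submodule.smul_mono_left hv.2 (hfrob.2 σ hσ x))
  exact W.mem_kolyvaginPrimes_torsionGaloisModule_one hv' hdvd hF

end NumberField

end WeierstrassCurve

/-! ## §4 The tower `k ↦ T_𝔮/p^k T_𝔮` over `S_m`: `𝓛₀` and `𝓛_s` of `ZpExtension.eisensteinAdicTower` -/

namespace Literature.NumberTheory.EllipticCurves

namespace ZpExtension

open Literature.NumberTheory.GaloisRepresentations Literature.NumberTheory.GaloisCohomology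
open Literature.NumberTheory.GaloisCohomology.Howard2004 (AdicTower)
open IwasawaAlgebra

section Level

variable {p : ℕ} [hp : Fact p.Prime] {m : ℕ} {M : ℕ → Type u} [∀ k, AddCommGroup (M k)]

/-- **The `S_m`-ideal `(p^s)` and the `A_{m,k}`-ideal `(p^s)` cut out the same subgroup of the level `M_k ⊗ A_{m,k}`**
(`S_m` acts through `S_m ↠ A_{m,k}`; both memberships say `x = p^s • y`).
[cite: Howard2004HeegnerKolyvagin, Def. 1.2.1 (I_ℓ ⊆ p^s R) and §2.2] -/
theorem EisensteinLevel.mem_span_pow_smul_top_iff (k s : ℕ) (x : EisensteinLevel p m M k) :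
    x ∈ (Ideal.span {((p : ℕ) : IwasawaAlgebra p ⧸
          Ideal.span {(PowerSeries.X ^ m + PowerSeries.C (p : ℤ_[p]) : IwasawaAlgebra p)}) ^ s} •
        (⊤ : Submodule (IwasawaAlgebra p ⧸
          Ideal.span {(PowerSeries.X ^ m + PowerSeries.C (p : ℤ_[p]) : IwasawaAlgebra p)}) (EisensteinLevel p m M k))) ↔
      EisensteinLevel.equivTwisted k x ∈
        (Ideal.span {((p : ℕ) : EisensteinCoeff p m k) ^ s} •
          (⊤ : Submodule (EisensteinCoeff p m k) (EisensteinCoeff.Twisted p m k (M k)))) := by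
  rw [mem_ideal_span_natCast_pow_smul_top_iff, mem_ideal_span_natCast_pow_smul_top_iff]
  rfl

end Level

section Tower

variable {K : Type} [Field K] [NumberField K] {p : ℕ} [hp : Fact p.Prime] (κ : ZpExtension K p)
  (W : WeierstrassCurve K) [W.IsElliptic] {m : ℕ} (hm : 1 ≤ m)
  (t : ∀ k, (W.torsionGaloisModule ((p : ℤ) ^ (k + 1))).toContRepresentation →ⁱL
    (W.torsionGaloisModule ((p : ℤ) ^ k)).toContRepresentation)
  (ht : ∀ k, Function.Surjective (t k))

/-- **`𝓛₀` of the tower `k ↦ E[p^k] ⊗ A_{m,k}(ψ)` is `⋂_k 𝓛₀(E[p^k])`** (lit's `AdicTower.degreeTwoPrimes` of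
`eisensteinAdicTower`). [cite: Howard2004HeegnerKolyvagin, §1.2 (arXiv p. 6, L54–60) and §1.6, §2.2] [cite: Washington1997, Prop. 13.2] -/
theorem degreeTwoPrimes_eisensteinAdicTower_eq :
    letI := IwasawaAlgebra.isLocalRing_quotient_X_pow_add_C p hm
    (κ.eisensteinAdicTower (fun k ↦ W.torsionGaloisModule ((p : ℤ) ^ k)) t hm ht).degreeTwoPrimes p =
      ⋂ k, Howard2004.degreeTwoPrimes p (W.torsionGaloisModule ((p : ℤ) ^ k)) := by
  letI := IwasawaAlgebra.isLocalRing_quotient_X_pow_add_C p hm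
  unfold AdicTower.degreeTwoPrimes
  refine Set.iInter_congr fun k ↦ ?_
  exact W.degreeTwoPrimes_eisensteinTwist_torsionGaloisModule_eq κ hm k

/-- The same for the tower re-indexed from level `1` (`eisensteinAdicTowerSucc`): `𝓛₀ = ⋂_k 𝓛₀(E[p^{k+1}])`.
[cite: Howard2004HeegnerKolyvagin, §1.2 and §1.6, §2.2] [cite: Washington1997, Prop. 13.2] -/
theorem degreeTwoPrimes_eisensteinAdicTowerSucc_eq :
    letI := IwasawaAlgebra.isLocalRing_quotient_X_pow_add_C p hm
    (κ.eisensteinAdicTowerSucc (fun k ↦ W.torsionGaloisModule ((p : ℤ) ^ k)) t hm ht).degreeTwoPrimes p =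
      ⋂ k, Howard2004.degreeTwoPrimes p (W.torsionGaloisModule ((p : ℤ) ^ (k + 1))) := by
  letI := IwasawaAlgebra.isLocalRing_quotient_X_pow_add_C p hm
  unfold AdicTower.degreeTwoPrimes
  refine Set.iInter_congr fun k ↦ ?_
  exact W.degreeTwoPrimes_eisensteinTwist_torsionGaloisModule_eq κ hm (k + 1)

/-- **`𝓛_s(T_𝔮) ⊆ ⋂_k 𝓛_1(E[p^{k+1}])`** for every `s ≥ 1`: a prime of lit's `AdicTower.kolyvaginPrimes p T s` for the
Eisenstein tower `T = (E[p^k] ⊗ A_{m,k}(ψ))_k` over `S_m` (the set quantified in `DVRSetting.LargePrimes`) is a degree-two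
prime `∤ p` at which every `E[p^{k+1}]` is unramified, with `p ∣ ℓ + 1` and `Frob_λ ≡ 1 (mod p)` on every `E[p^{k+1}]` —
Howard's «`𝓛_s(T) ⊂ 𝓛`» with `𝓛 = 𝓛_1` of the curve.
[cite: Howard2004HeegnerKolyvagin, Def. 1.2.1, Thm. 1.6.1 («𝓛_s(T) ⊂ 𝓛 for s ≫ 0»), proof of Thm. 2.2.10, §2.3 (𝓛 = 𝓛_1)]
[cite: Washington1997, Prop. 13.2] -/
theorem kolyvaginPrimes_eisensteinAdicTower_subset {s : ℕ} (hs : 1 ≤ s) :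
    letI := IwasawaAlgebra.isLocalRing_quotient_X_pow_add_C p hm
    (κ.eisensteinAdicTower (fun k ↦ W.torsionGaloisModule ((p : ℤ) ^ k)) t hm ht).kolyvaginPrimes p s ⊆
      ⋂ k, Howard2004.kolyvaginPrimes (R := ℤ) p (W.torsionGaloisModule ((p : ℤ) ^ (k + 1))) 1 := by
  letI := IwasawaAlgebra.isLocalRing_quotient_X_pow_add_C p hm
  intro v hv
  refine Set.mem_iInter.mpr fun k ↦ ?_
  obtain ⟨h0, h1, h2⟩ := hv
  have h0k := Set.mem_iInter.mp h0 (k + 1)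
  have h1' : ((Howard2004.residueChar v + 1 : ℕ) : EisensteinCoeff p m (k + 1)) ∈
      Ideal.span {((p : ℕ) : EisensteinCoeff p m (k + 1)) ^ 1} := by
    rw [pow_one, Ideal.mem_span_singleton]
    exact Nat.cast_dvd_cast (IwasawaAlgebra.dvd_of_natCast_mem_span_pow_quotient p hm hs h1)
  obtain ⟨hv', hdvd, hF⟩ := W.kolyvaginPrimes_conditions_of_eisensteinTwist κ hm (Nat.succ_pos k) le_rfl h0k h1'
    (fun σ hσ x ↦ by
      obtain ⟨y, hy⟩ := (mem_ideal_span_natCast_pow_smul_top_iff _ _ _).mp (h2 (k + 1) σ hσ x)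
      have hy' : κ.eisensteinTwist (W.torsionGaloisModule ((p : ℤ) ^ (k + 1))) hm (k + 1) σ x - x =
          p ^ s • (EisensteinLevel.equivTwisted (k + 1) y) := hy
      exact (mem_ideal_span_natCast_pow_smul_top_iff _ _ _).mpr ⟨p ^ (s - 1) • EisensteinLevel.equivTwisted (k + 1) y, by
        rw [hy', pow_one, ← mul_nsmul, ← pow_succ, Nat.sub_add_cancel hs]⟩)
  exact W.mem_kolyvaginPrimes_torsionGaloisModule_one hv' hdvd hF

/-- The same containment for the tower re-indexed from level `1` (`eisensteinAdicTowerSucc`, the indexing of lit's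
`DVRSetting`): **`𝓛_s ⊆ ⋂_k 𝓛_1(E[p^{k+1}])`** for every `s ≥ 1`.
[cite: Howard2004HeegnerKolyvagin, Def. 1.2.1, Thm. 1.6.1 («𝓛_s(T) ⊂ 𝓛 for s ≫ 0»), proof of Thm. 2.2.10, §2.3 (𝓛 = 𝓛_1)]
[cite: Washington1997, Prop. 13.2] -/
theorem kolyvaginPrimes_eisensteinAdicTowerSucc_subset {s : ℕ} (hs : 1 ≤ s) :
    letI := IwasawaAlgebra.isLocalRing_quotient_X_pow_add_C p hm
    (κ.eisensteinAdicTowerSucc (fun k ↦ W.torsionGaloisModule ((p : ℤ) ^ k)) t hm ht).kolyvaginPrimes p s ⊆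
      ⋂ k, Howard2004.kolyvaginPrimes (R := ℤ) p (W.torsionGaloisModule ((p : ℤ) ^ (k + 1))) 1 := by
  letI := IwasawaAlgebra.isLocalRing_quotient_X_pow_add_C p hm
  intro v hv
  refine Set.mem_iInter.mpr fun k ↦ ?_
  obtain ⟨h0, h1, h2⟩ := hv
  have h0k := Set.mem_iInter.mp h0 k
  have h1' : ((Howard2004.residueChar v + 1 : ℕ) : EisensteinCoeff p m (k + 1)) ∈
      Ideal.span {((p : ℕ) : EisensteinCoeff p m (k + 1)) ^ 1} := by
    rw [pow_one, Ideal.mem_span_singleton]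
    exact Nat.cast_dvd_cast (IwasawaAlgebra.dvd_of_natCast_mem_span_pow_quotient p hm hs h1)
  obtain ⟨hv', hdvd, hF⟩ := W.kolyvaginPrimes_conditions_of_eisensteinTwist κ hm (Nat.succ_pos k) le_rfl h0k h1'
    (fun σ hσ x ↦ by
      obtain ⟨y, hy⟩ := (mem_ideal_span_natCast_pow_smul_top_iff _ _ _).mp (h2 k σ hσ x)
      have hy' : κ.eisensteinTwist (W.torsionGaloisModule ((p : ℤ) ^ (k + 1))) hm (k + 1) σ x - x =
          p ^ s • (EisensteinLevel.equivTwisted (k + 1) y) := hy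
      exact (mem_ideal_span_natCast_pow_smul_top_iff _ _ _).mpr ⟨p ^ (s - 1) • EisensteinLevel.equivTwisted (k + 1) y, by
        rw [hy', pow_one, ← mul_nsmul, ← pow_succ, Nat.sub_add_cancel hs]⟩)
  exact W.mem_kolyvaginPrimes_torsionGaloisModule_one hv' hdvd hF

end Tower

end ZpExtension

end Literature.NumberTheory.EllipticCurves
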